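import Summits.SmoothPoincare4.SmoothPoincare4.Theorems.SymplecticOrigamiOrigamiFoldExistenceShadowPleatsCleanDefs
import Summits.SmoothPoincare4.SmoothPoincare4.Theorems.SymplecticOrigamiOrigamiFoldExistenceStubPleatFreeStandardSheets
import Literature.Topology.FourManifolds.HomotopyS4CompactProofs
import Mathlib.Geometry.Manifold.LocalDiffeomorph

/-!
# Stub `stub_cleanOnePleatIroning` of line `shadow-pleats` for crux `OrigamiFoldExistence` — II:
# cut-and-paste of an embedding over a pleat chart (item stmt-SmoothPoincare4-7844, route SymplecticOrigami; seat c3, S5a worker)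

Second helper file for the registered stub `stub_cleanOnePleatIroning` (S5a).  The deletion step
of Disproof.lean §7c (γ) replaces the embedding `ι : M → ℝ⁵` on the closed pleat ball
`D = e(B̄_R)` of a pleat chart `e : ℝ⁴ ↪ M` by a NEW smooth map `F : ℝ⁴ → ℝ⁵` of the model ball
which agrees with `ι ∘ e` on a thin shell `R ≤ |u| ≤ R + η`:

  `patch ι e R F m = F (e⁻¹ m)` for `m ∈ e(B̄_R)`,   `= ι m` otherwise.

This file proves, once and for all and with no topology beyond point-set, WHEN the patched map
is again a smooth embedding and what it does to a round-rim position: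

* `isLocalDiffeomorphAt_pleatChart`, `isOpenMap_pleatChart` — a pleat chart (a `C^∞` embedding
  `ℝ⁴ → M⁴`) is a local diffeomorphism and an open map (inverse function theorem, tree form
  `isLocalDiffeomorphAt_of_injective_mfderiv_four`);
* `contMDiffAt_comp_invFun`, `injective_mfderiv_comp_invFun` — `F ∘ e⁻¹` is smooth on the
  image of `e` with differential `dF ∘ (de)⁻¹`;
* `contMDiff_patch` (open cover `e(B_{R+η}) ∪ (M ∖ e(B̄_R))`), `injective_patch` (from
  `F` injective on `B̄_R` and the SEPARATION hypothesis `ι(M ∖ e B̄_R) ∩ F(B̄_R) = ∅` — the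
  unthreadedness of (γ)), `isSmoothEmbedding_patch` (Hirsch's criterion on the compact `M`);
* `round_patch` — the round clause is untouched when old and new ball points lie strictly above
  the plane; `injective_mfderiv_shadow_patch_*` — the shadow of the patched map is immersive
  on the ball as soon as `proj5 ∘ F` is, and off the ball it is the old shadow;

File III (`…StubCleanOnePleatIroningDeletion.lean`) assembles these into the deletion lemma
(`hasPleatedPosition_zero_of_patch`) and feeds it with the graphical `F u = (Λ u, h(ι (e u)))`
of an IRONING CHART `Λ`, reducing the stub to the existence of such a chart.

Sources: Disproof.lean §7c (γ); Hirsch, *Differential Topology* (1976) Ch. 1 §3 Thm. 3.1;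
Lee, *Introduction to Smooth Manifolds* (2013) Thm. 4.5.
-/

noncomputable section

-- the prescribed namespace `Summit.<P>.<Sub>.…` duplicates `SmoothPoincare4` (P = Sub)
set_option linter.dupNamespace false

open scoped Manifold ContDiff Topology
open Set Function Filter Metric

namespace Summit.SmoothPoincare4.SmoothPoincare4.Theorems.OrigamiFoldExistence.ShadowPleats

/-! ### Pleat charts are local diffeomorphisms; smooth maps through `e⁻¹` -/

section Chart

variable {M : Type} [TopologicalSpace M] [ChartedSpace (EuclideanSpace ℝ (Fin 4)) M]
  [IsManifold (𝓡 4) ∞ M] {e : EuclideanSpace ℝ (Fin 4) → M}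

/-- A `C^∞` embedding `ℝ⁴ → M⁴` is a local diffeomorphism at every point (its differential is
injective between `4`-dimensional spaces; inverse function theorem). [folklore] -/
theorem isLocalDiffeomorphAt_pleatChart (he : Manifold.IsSmoothEmbedding (𝓡 4) (𝓡 4) ∞ e)
    (u : EuclideanSpace ℝ (Fin 4)) : IsLocalDiffeomorphAt (𝓡 4) (𝓡 4) ∞ e u :=
  isLocalDiffeomorphAt_of_injective_mfderiv_four he.contMDiff
    (Literature.Topology.FourManifolds.injective_mfderiv_of_isImmersionAt'
      (he.isImmersion.isImmersionAt u))

/-- A `C^∞` embedding `ℝ⁴ → M⁴` is a local diffeomorphism. -/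
theorem isLocalDiffeomorph_pleatChart (he : Manifold.IsSmoothEmbedding (𝓡 4) (𝓡 4) ∞ e) :
    IsLocalDiffeomorph (𝓡 4) (𝓡 4) ∞ e :=
  fun u => isLocalDiffeomorphAt_pleatChart he u

/-- A `C^∞` embedding `ℝ⁴ → M⁴` is an open map. [folklore] -/
theorem isOpenMap_pleatChart (he : Manifold.IsSmoothEmbedding (𝓡 4) (𝓡 4) ∞ e) : IsOpenMap e :=
  (isLocalDiffeomorph_pleatChart he).isOpenMap

omit [IsManifold (𝓡 4) ∞ M] in
/-- `e⁻¹ ∘ e = id` for the set-theoretic inverse `Function.invFun e` of an embedding. -/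
theorem invFun_pleatChart_apply (he : Manifold.IsSmoothEmbedding (𝓡 4) (𝓡 4) ∞ e)
    (u : EuclideanSpace ℝ (Fin 4)) : invFun e (e u) = u :=
  leftInverse_invFun he.isEmbedding.injective u

/-- Near a point of the image, `e⁻¹` is the smooth local inverse of `e`. -/
theorem invFun_eventuallyEq_localInverse (he : Manifold.IsSmoothEmbedding (𝓡 4) (𝓡 4) ∞ e)
    (u : EuclideanSpace ℝ (Fin 4)) :
    invFun e =ᶠ[𝓝 (e u)] (isLocalDiffeomorphAt_pleatChart he u).localInverse := by
  set L := isLocalDiffeomorphAt_pleatChart he u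
  filter_upwards [L.localInverse.open_source.mem_nhds L.localInverse_mem_source] with y hy
  have h1 : e (L.localInverse y) = y := L.localInverse_right_inv hy
  calc invFun e y = invFun e (e (L.localInverse y)) := by rw [h1]
    _ = L.localInverse y := invFun_pleatChart_apply he _

variable {X : Type} [NormedAddCommGroup X] [NormedSpace ℝ X] {F : EuclideanSpace ℝ (Fin 4) → X}

/-- **`F ∘ e⁻¹` is smooth at every point of the image of the chart** (`F : ℝ⁴ → X` smooth). -/
theorem contMDiffAt_comp_invFun (he : Manifold.IsSmoothEmbedding (𝓡 4) (𝓡 4) ∞ e)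
    (hF : ContDiff ℝ ∞ F) (u : EuclideanSpace ℝ (Fin 4)) :
    ContMDiffAt (𝓡 4) 𝓘(ℝ, X) ∞ (F ∘ invFun e) (e u) := by
  set L := isLocalDiffeomorphAt_pleatChart he u
  have hev : F ∘ invFun e =ᶠ[𝓝 (e u)] F ∘ L.localInverse := by
    filter_upwards [invFun_eventuallyEq_localInverse he u] with y hy
    simp only [Function.comp_apply, hy]
  refine ContMDiffAt.congr_of_eventuallyEq ?_ hev
  exact hF.contMDiff.contMDiffAt.comp (e u) L.localInverse_contMDiffAt

/-- **Chain rule through the chart**: `dF_u = d(F ∘ e⁻¹)_{e u} ∘ de_u`. -/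
theorem mfderiv_comp_invFun_comp (he : Manifold.IsSmoothEmbedding (𝓡 4) (𝓡 4) ∞ e)
    (hF : ContDiff ℝ ∞ F) (u : EuclideanSpace ℝ (Fin 4)) :
    fderiv ℝ F u =
      (mfderiv (𝓡 4) 𝓘(ℝ, X) (F ∘ invFun e) (e u)).comp (mfderiv (𝓡 4) (𝓡 4) e u) := by
  have hfun : F = (F ∘ invFun e) ∘ e := by
    funext u'
    simp [invFun_pleatChart_apply he]
  have hn : (∞ : WithTop ℕ∞) ≠ 0 := by simp
  have h1 : MDifferentiableAt (𝓡 4) (𝓡 4) e u := (he.contMDiff u).mdifferentiableAt hn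
  have h2 : MDifferentiableAt (𝓡 4) 𝓘(ℝ, X) (F ∘ invFun e) (e u) :=
    (contMDiffAt_comp_invFun he hF u).mdifferentiableAt hn
  have hcomp := mfderiv_comp u h2 h1
  rw [← hfun] at hcomp
  rw [← hcomp, mfderiv_eq_fderiv]

/-- **If `dF_u` is injective then so is `d(F ∘ e⁻¹)_{e u}`** (`de_u` is an isomorphism). -/
theorem injective_mfderiv_comp_invFun (he : Manifold.IsSmoothEmbedding (𝓡 4) (𝓡 4) ∞ e)
    (hF : ContDiff ℝ ∞ F) {u : EuclideanSpace ℝ (Fin 4)} (hinj : Injective (fderiv ℝ F u)) :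
    Injective (mfderiv (𝓡 4) 𝓘(ℝ, X) (F ∘ invFun e) (e u)) := by
  have hn : (∞ : WithTop ℕ∞) ≠ 0 := by simp
  set B := (isLocalDiffeomorphAt_pleatChart he u).mfderivToContinuousLinearEquiv hn with hB
  rw [mfderiv_comp_invFun_comp he hF u] at hinj
  intro v₁ v₂ h
  obtain ⟨w₁, rfl⟩ := B.surjective v₁
  obtain ⟨w₂, rfl⟩ := B.surjective v₂
  have : w₁ = w₂ := hinj h
  rw [this]

end Chart

/-! ### The patched map -/

open Classical in
/-- The CUT-AND-PASTE of `ι : M → ℝ⁵` over the chart ball `e(B̄_R)` by `F : ℝ⁴ → ℝ⁵`: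
`F ∘ e⁻¹` on `e(B̄_R)`, `ι` elsewhere. -/
def patch {M : Type} (ι : M → EuclideanSpace ℝ (Fin 5)) (e : EuclideanSpace ℝ (Fin 4) → M) (R : ℝ)
    (F : EuclideanSpace ℝ (Fin 4) → EuclideanSpace ℝ (Fin 5)) (m : M) : EuclideanSpace ℝ (Fin 5) :=
  if m ∈ e '' closedBall 0 R then F (invFun e m) else ι m

section Patch

variable {M : Type} {ι : M → EuclideanSpace ℝ (Fin 5)} {e : EuclideanSpace ℝ (Fin 4) → M} {R η : ℝ}
  {F : EuclideanSpace ℝ (Fin 4) → EuclideanSpace ℝ (Fin 5)}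

/-- On the chart ball the patched map is `F ∘ e⁻¹`. -/
theorem patch_of_mem {m : M} (hm : m ∈ e '' closedBall 0 R) : patch ι e R F m = F (invFun e m) := by
  simp [patch, hm]

/-- Off the chart ball the patched map is `ι`. -/
theorem patch_of_notMem {m : M} (hm : m ∉ e '' closedBall 0 R) : patch ι e R F m = ι m := by
  simp only [patch, if_neg hm]

/-- In the chart, on the closed ball, the patched map is `F`. -/
theorem patch_chart_of_le (he : Injective e) {u : EuclideanSpace ℝ (Fin 4)} (hu : ‖u‖ ≤ R) :
    patch ι e R F (e u) = F u := by
  rw [patch_of_mem ⟨u, mem_closedBall_zero_iff.2 hu, rfl⟩, leftInverse_invFun he u]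

/-- A chart point outside the closed ball is not in the image of the closed ball. -/
theorem chart_notMem_image (he : Injective e) {u : EuclideanSpace ℝ (Fin 4)} (hu : R < ‖u‖) :
    e u ∉ e '' closedBall 0 R := by
  rintro ⟨u', hu', h⟩
  rw [he h, mem_closedBall_zero_iff] at hu'
  exact absurd hu' (not_le.2 hu)

/-- In the chart, on the thickened ball `B_{R+η}`, the patched map is `F` — given that `F`
agrees with `ι ∘ e` on the shell `R ≤ |u| ≤ R + η`. -/
theorem patch_chart_of_lt (he : Injective e)
    (hagree : ∀ u, R ≤ ‖u‖ → ‖u‖ ≤ R + η → F u = ι (e u)) {u : EuclideanSpace ℝ (Fin 4)}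
    (hu : ‖u‖ < R + η) : patch ι e R F (e u) = F u := by
  by_cases h : ‖u‖ ≤ R
  · exact patch_chart_of_le he h
  · rw [patch_of_notMem (chart_notMem_image he (not_le.1 h)), hagree u (not_le.1 h).le hu.le]

/-- On the open set `e(B_{R+η})` the patched map is `F ∘ e⁻¹`. -/
theorem patch_eqOn_image_ball (he : Injective e)
    (hagree : ∀ u, R ≤ ‖u‖ → ‖u‖ ≤ R + η → F u = ι (e u)) :
    EqOn (patch ι e R F) (F ∘ invFun e) (e '' ball 0 (R + η)) := by
  rintro m ⟨u, hu, rfl⟩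
  rw [Function.comp_apply, leftInverse_invFun he u]
  exact patch_chart_of_lt he hagree (mem_ball_zero_iff.1 hu)

/-- **The patched map is injective** if `ι` and `e` are, `F` is injective on the closed ball, and
(SEPARATION) no point of `M` off the chart ball is mapped by `ι` into `F(B̄_R)`. [folklore] -/
theorem injective_patch (hι : Injective ι) (he : Injective e) (hF : InjOn F (closedBall 0 R))
    (hsep : ∀ m, m ∉ e '' closedBall 0 R → ι m ∉ F '' closedBall 0 R) :
    Injective (patch ι e R F) := by
  intro m m' h
  by_cases hm : m ∈ e '' closedBall 0 R <;> by_cases hm' : m' ∈ e '' closedBall 0 R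
  · obtain ⟨u, hu, rfl⟩ := hm
    obtain ⟨u', hu', rfl⟩ := hm'
    rw [patch_chart_of_le he (mem_closedBall_zero_iff.1 hu),
      patch_chart_of_le he (mem_closedBall_zero_iff.1 hu')] at h
    rw [hF hu hu' h]
  · obtain ⟨u, hu, rfl⟩ := hm
    rw [patch_chart_of_le he (mem_closedBall_zero_iff.1 hu), patch_of_notMem hm'] at h
    exact absurd ⟨u, hu, h⟩ (hsep m' hm')
  · obtain ⟨u', hu', rfl⟩ := hm'
    rw [patch_chart_of_le he (mem_closedBall_zero_iff.1 hu'), patch_of_notMem hm] at h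
    exact absurd ⟨u', hu', h.symm⟩ (hsep m hm)
  · rw [patch_of_notMem hm, patch_of_notMem hm'] at h
    exact hι h

/-- **The round clause is untouched** by a patch whose old and new ball points lie strictly above
the plane. [folklore] -/
theorem round_patch {δ : ℝ} (he : Injective e)
    (hround : Set.range ι ∩ {p : EuclideanSpace ℝ (Fin 5) | p 4 ≤ 1 - δ} =
      (Metric.sphere (0 : EuclideanSpace ℝ (Fin 5)) 1 : Set (EuclideanSpace ℝ (Fin 5))) ∩
        {p : EuclideanSpace ℝ (Fin 5) | p 4 ≤ 1 - δ})
    (hold : ∀ u, 1 - δ < ι (e u) 4) (hnew : ∀ u, ‖u‖ ≤ R → 1 - δ < F u 4) :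
    Set.range (patch ι e R F) ∩ {p : EuclideanSpace ℝ (Fin 5) | p 4 ≤ 1 - δ} =
      (Metric.sphere (0 : EuclideanSpace ℝ (Fin 5)) 1 : Set (EuclideanSpace ℝ (Fin 5))) ∩
        {p : EuclideanSpace ℝ (Fin 5) | p 4 ≤ 1 - δ} := by
  rw [← hround]
  ext p
  constructor
  · rintro ⟨⟨m, rfl⟩, hp⟩
    have hp' : patch ι e R F m 4 ≤ 1 - δ := hp
    by_cases hm : m ∈ e '' closedBall 0 R
    · obtain ⟨u, hu, rfl⟩ := hm
      have hle : ‖u‖ ≤ R := mem_closedBall_zero_iff.1 hu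
      rw [patch_chart_of_le he hle] at hp'
      exact absurd hp' (not_le.2 (hnew u hle))
    · refine ⟨⟨m, (patch_of_notMem hm).symm⟩, ?_⟩
      exact hp
  · rintro ⟨⟨m, rfl⟩, hp⟩
    have hp' : ι m 4 ≤ 1 - δ := hp
    have hm : m ∉ e '' closedBall 0 R := by
      rintro ⟨u, -, rfl⟩
      exact absurd hp' (not_le.2 (hold u))
    exact ⟨⟨m, patch_of_notMem hm⟩, hp⟩

end Patch

/-! ### Smoothness, embedding and shadow of the patched map -/

section Smooth

variable {M : Type} [TopologicalSpace M] [ChartedSpace (EuclideanSpace ℝ (Fin 4)) M]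
  [IsManifold (𝓡 4) ∞ M] {ι : M → EuclideanSpace ℝ (Fin 5)} {e : EuclideanSpace ℝ (Fin 4) → M}
  {R η : ℝ} {F : EuclideanSpace ℝ (Fin 4) → EuclideanSpace ℝ (Fin 5)}

/-- Near a point of the thickened chart ball the patched map is `F ∘ e⁻¹`. -/
theorem patch_eventuallyEq_chart (he : Manifold.IsSmoothEmbedding (𝓡 4) (𝓡 4) ∞ e)
    (hagree : ∀ u, R ≤ ‖u‖ → ‖u‖ ≤ R + η → F u = ι (e u)) {u : EuclideanSpace ℝ (Fin 4)}
    (hu : ‖u‖ < R + η) : patch ι e R F =ᶠ[𝓝 (e u)] F ∘ invFun e := by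
  have hopen : IsOpen (e '' ball 0 (R + η)) := isOpenMap_pleatChart he _ isOpen_ball
  exact Filter.eventuallyEq_of_mem (hopen.mem_nhds ⟨u, mem_ball_zero_iff.2 hu, rfl⟩)
    (patch_eqOn_image_ball he.isEmbedding.injective hagree)

omit [IsManifold (𝓡 4) ∞ M] in
/-- Near a point off the (closed, compact) chart ball the patched map is `ι`. -/
theorem patch_eventuallyEq_of_notMem [T2Space M] (he : Manifold.IsSmoothEmbedding (𝓡 4) (𝓡 4) ∞ e)
    {m : M} (hm : m ∉ e '' closedBall 0 R) : patch ι e R F =ᶠ[𝓝 m] ι := by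
  have hclosed : IsClosed (e '' closedBall (0 : EuclideanSpace ℝ (Fin 4)) R) :=
    ((isCompact_closedBall 0 R).image he.contMDiff.continuous).isClosed
  refine Filter.eventuallyEq_of_mem (hclosed.isOpen_compl.mem_nhds hm) ?_
  intro m' hm'
  exact patch_of_notMem hm'

/-- **The patched map is smooth** (`ι` smooth, `e` a smooth chart, `F` smooth and equal to
`ι ∘ e` on the shell `R ≤ |u| ≤ R + η`, `η > 0`). [folklore] -/
theorem contMDiff_patch [T2Space M] (hι : ContMDiff (𝓡 4) (𝓡 5) ∞ ι)
    (he : Manifold.IsSmoothEmbedding (𝓡 4) (𝓡 4) ∞ e) (hF : ContDiff ℝ ∞ F) (hη : 0 < η)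
    (hagree : ∀ u, R ≤ ‖u‖ → ‖u‖ ≤ R + η → F u = ι (e u)) :
    ContMDiff (𝓡 4) (𝓡 5) ∞ (patch ι e R F) := by
  intro m
  by_cases hm : m ∈ e '' closedBall 0 R
  · obtain ⟨u, hu, rfl⟩ := hm
    have hu' : ‖u‖ < R + η := by
      have := mem_closedBall_zero_iff.1 hu
      linarith
    exact (contMDiffAt_comp_invFun he hF u).congr_of_eventuallyEq
      (patch_eventuallyEq_chart he hagree hu')
  · exact (hι m).congr_of_eventuallyEq (patch_eventuallyEq_of_notMem he hm)

/-- On the closed chart ball the differential of the patched map is injective where `dF` is. -/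
theorem injective_mfderiv_patch_chart (he : Manifold.IsSmoothEmbedding (𝓡 4) (𝓡 4) ∞ e)
    (hF : ContDiff ℝ ∞ F) (hagree : ∀ u, R ≤ ‖u‖ → ‖u‖ ≤ R + η → F u = ι (e u))
    {u : EuclideanSpace ℝ (Fin 4)} (hu : ‖u‖ < R + η) (hd : Injective (fderiv ℝ F u)) :
    Injective (mfderiv (𝓡 4) (𝓡 5) (patch ι e R F) (e u)) := by
  rw [(patch_eventuallyEq_chart he hagree hu).mfderiv_eq]
  exact injective_mfderiv_comp_invFun he hF hd

omit [IsManifold (𝓡 4) ∞ M] in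
/-- Off the chart ball the differential of the patched map is that of `ι`. -/
theorem mfderiv_patch_of_notMem [T2Space M] (he : Manifold.IsSmoothEmbedding (𝓡 4) (𝓡 4) ∞ e)
    {m : M} (hm : m ∉ e '' closedBall 0 R) :
    mfderiv (𝓡 4) (𝓡 5) (patch ι e R F) m = mfderiv (𝓡 4) (𝓡 5) ι m :=
  (patch_eventuallyEq_of_notMem he hm).mfderiv_eq

/-- **The patched map is a `C^∞` embedding** of the compact `M` (Hirsch's criterion): smooth,
injective (separation hypothesis), immersive (`dF` injective on the closed ball). [folklore] -/
theorem isSmoothEmbedding_patch [T2Space M] [CompactSpace M]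
    (hι : Manifold.IsSmoothEmbedding (𝓡 4) (𝓡 5) ∞ ι)
    (he : Manifold.IsSmoothEmbedding (𝓡 4) (𝓡 4) ∞ e) (hF : ContDiff ℝ ∞ F) (hη : 0 < η)
    (hagree : ∀ u, R ≤ ‖u‖ → ‖u‖ ≤ R + η → F u = ι (e u))
    (hFinj : InjOn F (closedBall 0 R)) (hd : ∀ u, ‖u‖ ≤ R → Injective (fderiv ℝ F u))
    (hsep : ∀ m, m ∉ e '' closedBall 0 R → ι m ∉ F '' closedBall 0 R) :
    Manifold.IsSmoothEmbedding (𝓡 4) (𝓡 5) ∞ (patch ι e R F) := by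
  refine Literature.Topology.FourManifolds.isSmoothEmbedding_of_injective_of_injective_mfderiv
    (contMDiff_patch hι.contMDiff he hF hη hagree) (by simp)
    (injective_patch hι.isEmbedding.injective he.isEmbedding.injective hFinj hsep) ?_
  intro m
  by_cases hm : m ∈ e '' closedBall 0 R
  · obtain ⟨u, hu, rfl⟩ := hm
    have hle : ‖u‖ ≤ R := mem_closedBall_zero_iff.1 hu
    exact injective_mfderiv_patch_chart he hF hagree (by linarith) (hd u hle)
  · rw [mfderiv_patch_of_notMem he hm]
    exact injective_mfderiv_of_emb hι m

/-- The shadow of the patched map, on the closed chart ball, is immersive where `proj5 ∘ F` is. -/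
theorem injective_mfderiv_shadow_patch_chart (he : Manifold.IsSmoothEmbedding (𝓡 4) (𝓡 4) ∞ e)
    (hF : ContDiff ℝ ∞ F) (hagree : ∀ u, R ≤ ‖u‖ → ‖u‖ ≤ R + η → F u = ι (e u))
    {u : EuclideanSpace ℝ (Fin 4)} (hu : ‖u‖ < R + η)
    (hd : Injective (fderiv ℝ (proj5 ∘ F) u)) :
    Injective (mfderiv (𝓡 4) (𝓡 4) (proj5 ∘ patch ι e R F) (e u)) := by
  have hev : proj5 ∘ patch ι e R F =ᶠ[𝓝 (e u)] (proj5 ∘ F) ∘ invFun e := by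
    filter_upwards [patch_eventuallyEq_chart he hagree hu] with m hm
    simp only [Function.comp_apply, hm]
  rw [hev.mfderiv_eq]
  have hpF : ContDiff ℝ ∞ (proj5 ∘ F) := by
    rw [← coe_proj5L]
    exact proj5L.contDiff.comp hF
  exact injective_mfderiv_comp_invFun he hpF hd

omit [IsManifold (𝓡 4) ∞ M] in
/-- The shadow of the patched map, off the chart ball, has the differential of the old shadow. -/
theorem mfderiv_shadow_patch_of_notMem [T2Space M] (he : Manifold.IsSmoothEmbedding (𝓡 4) (𝓡 4) ∞ e)
    {m : M} (hm : m ∉ e '' closedBall 0 R) :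
    mfderiv (𝓡 4) (𝓡 4) (proj5 ∘ patch ι e R F) m = mfderiv (𝓡 4) (𝓡 4) (proj5 ∘ ι) m := by
  have hev : proj5 ∘ patch ι e R F =ᶠ[𝓝 m] proj5 ∘ ι := by
    filter_upwards [patch_eventuallyEq_of_notMem (ι := ι) (F := F) he hm] with m' hm'
    simp only [Function.comp_apply, hm']
  exact hev.mfderiv_eq

end Smooth



end Summit.SmoothPoincare4.SmoothPoincare4.Theorems.OrigamiFoldExistence.ShadowPleats

end
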